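import Mathlib
import HarnessLib

/-!
# Route `RadicialJung`, crux `CleanModels` (stmt-ResolutionOfSingularities-15917), line `Sketch` rev 35, stub 6 `stub_cleanProp44` (X44c):
# THE TOP STOREY OF THE σ-TOWER, ALGEBRA — a localization of `K[X]` read through `X ↦ w` is a localization of `K[X]` read through `X ↦ w⁻¹`

Seat decomp-res-hand-2 g23 (structural hand).  The chained σ-tower ✓ `sigmaTower` reads the exceptional divisor `S = 𝒪_{x′}/(τ♯v)` as a localization
of `K[T]` with `T ↦ t′ = t/v` at points of the STRICT TRANSFORM OF THE LEAF (`t′ ∈ 𝔪`, the `v`-chart is forced).  The births `c′ ∈ Γ″ = {T + λ(u) = 0}`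
and the generic point `η″` of the near curve are NOT on the leaf when `λ(P) ≠ 0`: there `t′` is a unit, the point lies in both charts, and the tree's chart
lemma (✓ `exists_chart_localization_of_isBlowup`, chart index existential) may present `S` through the `t`-chart, i.e. as a localization of `K[X]` with
`X ↦ s = v/t = t′⁻¹`.  This file supplies the algebra that makes the chart irrelevant:

* `map_reflect_eq` — for two ring maps `φ₁, φ₂ : K[X] → S` agreeing on `K` with `φ₁ X · φ₂ X = 1`: `φ₂ (reflect m f) = φ₁ f · φ₂ X ^ m`
  (`deg f ≤ m`; Mathlib's `eval₂_reflect_mul_pow`).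
* `exists_isLocalization_of_mul_X_eq_one` — **if `S` is a localization of `K[X]` through `φ₁` (at some submonoid), it is a localization of `K[X]`
  through `φ₂`** (at the submonoid of all `q` with `φ₂ q` a unit): surjectivity and the kernel condition are transported by `reflect`.

Honest framing: OURS, elementary; consumed by the top storey of the σ-tower (sequel file); nothing here proves X44c, any case of `CleanModels`, or resolution
of singularities in characteristic `p`. [cite: Matsumura1987, Thm. 4.1–4.3] [cite: CossartPiltant2008, Prop. 4.4 (proof, p. 11)]
-/

noncomputable section

set_option linter.dupNamespace false -- mandated namespace of this single-conjunct summit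

open Polynomial

namespace Summit.ResolutionOfSingularities.ResolutionOfSingularities.Theorems.RadicialJung.CleanModels

section Invert

variable {K S : Type*} [CommRing K] [CommRing S] (φ₁ φ₂ : K[X] →+* S)
  (hC : ∀ a : K, φ₁ (C a) = φ₂ (C a)) (hX : φ₁ X * φ₂ X = 1)

/-- A ring map out of `K[X]` is `eval₂` of its restriction to `K` at the image of `X`. [folklore] -/
theorem ringHom_apply_eq_eval₂ (φ : K[X] →+* S) (f : K[X]) : φ f = eval₂ (φ.comp C) (φ X) f := by
  conv_lhs => rw [← eval₂_C_X (p := f)]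
  rw [hom_eval₂]

include hC hX in
/-- **`φ₂ (reflect m f) = φ₁ f · (φ₂ X)^m`** for `deg f ≤ m`, when `φ₁`, `φ₂` agree on `K` and `φ₁ X · φ₂ X = 1`. [folklore] -/
theorem map_reflect_eq (f : K[X]) {m : ℕ} (hf : f.natDegree ≤ m) : φ₂ (reflect m f) = φ₁ f * φ₂ X ^ m := by
  letI : Invertible (φ₁ X) := ⟨φ₂ X, by rw [mul_comm]; exact hX, hX⟩
  have hcomp : φ₂.comp C = φ₁.comp C := RingHom.ext fun a => (hC a).symm
  have h1 : φ₂ (reflect m f) = eval₂ (φ₁.comp C) (⅟ (φ₁ X)) (reflect m f) := by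
    rw [ringHom_apply_eq_eval₂ φ₂, hcomp]; rfl
  have h2 := eval₂_reflect_mul_pow (φ₁.comp C) (φ₁ X) m f hf
  rw [← ringHom_apply_eq_eval₂ φ₁] at h2
  rw [h1, ← h2, mul_assoc, ← mul_pow, hX, one_pow, mul_one]

include hC hX in
/-- The symmetric identity: `φ₁ (reflect m f) = φ₂ f · (φ₁ X)^m`. [folklore] -/
theorem map_reflect_eq' (f : K[X]) {m : ℕ} (hf : f.natDegree ≤ m) : φ₁ (reflect m f) = φ₂ f * φ₁ X ^ m :=
  map_reflect_eq φ₂ φ₁ (fun a => (hC a).symm) (by rw [mul_comm]; exact hX) f hf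

include hC hX in
/-- **A localization of `K[X]` through `X ↦ w` is a localization of `K[X]` through `X ↦ w⁻¹`.**  If `S` is a localization of `K[X]` at `N₁` for the
structure `φ₁`, then `S` is a localization of `K[X]` for the structure `φ₂` (agreeing with `φ₁` on `K`, `φ₁ X · φ₂ X = 1`) at the submonoid of all `q`
with `φ₂ q` a unit. [cite: Matsumura1987, Thm. 4.1–4.3] -/
theorem exists_isLocalization_of_mul_X_eq_one (N₁ : Submonoid K[X]) (h₁ : @IsLocalization K[X] _ N₁ S _ φ₁.toAlgebra) :
    ∃ N₂ : Submonoid K[X], @IsLocalization K[X] _ N₂ S _ φ₂.toAlgebra := by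
  obtain ⟨H1, H2, H3⟩ := (@isLocalization_iff K[X] _ N₁ S _ φ₁.toAlgebra).mp h₁
  have halg₁ : ∀ q, @algebraMap K[X] S _ _ φ₁.toAlgebra q = φ₁ q := fun q => rfl
  simp only [halg₁] at H1 H2 H3
  refine ⟨(IsUnit.submonoid S).comap φ₂, (@isLocalization_iff K[X] _ _ S _ φ₂.toAlgebra).mpr ⟨?_, ?_, ?_⟩⟩
  · -- units by definition
    rintro ⟨q, hq⟩
    exact hq
  · -- surjectivity, transported by `reflect`
    intro z
    obtain ⟨⟨a, n⟩, hz⟩ := H2 z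
    set M := max a.natDegree (n : K[X]).natDegree with hM
    have hn : IsUnit (φ₂ (reflect M (n : K[X]))) := by
      rw [map_reflect_eq φ₁ φ₂ hC hX _ (le_max_right _ _)]
      exact (H1 n).mul ((IsUnit.of_mul_eq_one_right _ hX).pow M)
    refine ⟨⟨reflect M a, ⟨reflect M (n : K[X]), hn⟩⟩, ?_⟩
    change z * φ₂ (reflect M (n : K[X])) = φ₂ (reflect M a)
    rw [map_reflect_eq φ₁ φ₂ hC hX _ (le_max_right _ _), map_reflect_eq φ₁ φ₂ hC hX _ (le_max_left _ _), ← mul_assoc]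
    change z * φ₁ ↑n * φ₂ X ^ M = φ₁ a * φ₂ X ^ M
    rw [hz]
  · -- the kernel condition, transported by `reflect` twice
    intro a b hab
    change φ₂ a = φ₂ b at hab
    set M := max a.natDegree b.natDegree with hM
    have h1 : φ₁ (reflect M a) = φ₁ (reflect M b) := by
      rw [map_reflect_eq' φ₁ φ₂ hC hX _ (le_max_left _ _), map_reflect_eq' φ₁ φ₂ hC hX _ (le_max_right _ _), hab]
    obtain ⟨c, hc⟩ := H3 h1
    set D := (c : K[X]).natDegree with hD
    have hc' : IsUnit (φ₂ (reflect D (c : K[X]))) := by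
      rw [map_reflect_eq φ₁ φ₂ hC hX _ le_rfl]
      exact (H1 c).mul ((IsUnit.of_mul_eq_one_right _ hX).pow D)
    refine ⟨⟨reflect D (c : K[X]), hc'⟩, ?_⟩
    change reflect D (c : K[X]) * a = reflect D (c : K[X]) * b
    have hra : (reflect M a).natDegree ≤ M := (natDegree_reflect_le).trans (max_le le_rfl (le_max_left _ _))
    have hrb : (reflect M b).natDegree ≤ M := (natDegree_reflect_le).trans (max_le le_rfl (le_max_right _ _))
    have key := congrArg (reflect (D + M)) hc
    rw [reflect_mul _ _ le_rfl hra, reflect_mul _ _ le_rfl hrb, reflect_reflect, reflect_reflect] at key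
    exact key

end Invert

end Summit.ResolutionOfSingularities.ResolutionOfSingularities.Theorems.RadicialJung.CleanModels

end
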